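import Literature.Analysis.FunctionSpaces.MinkowskiIntegral
import Literature.Analysis.FluidPDE.OseenDuhamelPairCalculus
import Literature.Analysis.FluidPDE.TaoLocalisationProofs
import HarnessLib

/-!
# Planar `L²` norms under the heat flow and the Oseen bilinear term (planar Young inequalities)

Route `PlaneEnergyCeiling`, crux `PlanarEnergyAPriori` (stmt-NavierStokesRegularity-16855), tools for
its small-data corner. The route's object is the **planar kinetic energy**
`∫_{R({x₂ = c})} ‖f‖² dA` of a field `f` on `ℝ³` through the plane `y ↦ R (y₀, y₁, c)`
(`R` a linear isometry, `c ∈ ℝ`), and its supremum over all planes. This file proves that the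
supremum is not increased by the heat flow and controls the Oseen bilinear term:

* `plane_sub`, `lintegral_plane_translate`, `planar_translate_le` — a translate of a plane is a
  plane: `R(y₀,y₁,c) − z = R((y − w)₀, (y − w)₁, c − (R⁻¹z)₂)`, so a planar ceiling valid for all
  planes is valid for all translated parametrisations;
* `planar_heatExtension_le` — `∫_{plane} ‖e^{σΔ}f‖² ≤ sup_{planes} ∫ ‖f‖²` (Minkowski's integral
  inequality in the kernel variable, `‖G_σ‖₁ = 1`);
* `planar_oseenSlice_le` — `(∫_{plane} ‖N_τ[a,b]‖²)^{1/2} ≤ C₁ τ^{-1/2} ‖a‖_∞ (sup_{planes} ∫‖b‖²)^{1/2}`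
  (Minkowski with the Koch–Tataru envelope `C (τ + ‖z‖²)^{-2}` of the Oseen kernel, of mass
  `C I τ^{-1/2}`);
* `planar_oseenDuhamel_le` — Minkowski in time:
  `(∫_{plane} ‖B_{t₀}(w,w)(t)‖²)^{1/2} ≤ ∫_{t₀}^t m(s) ds` whenever `m(s)` bounds the planar norms of
  the slices `N_{t−s}[w(s), w(s)]`.

All statements are over the tree's Minkowski integral inequality
`FunctionSpaces.eLpNorm_integral_le_lintegral_eLpNorm` (Stein 1970, App. A.1).

## References

* E. M. Stein, *Singular Integrals and Differentiability Properties of Functions* (1970), App. A.1.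
  [SteinSingularIntegrals1970]
* G. Koch, N. Nadirashvili, G. Seregin, V. Šverák, Acta Math. 203 (2009), §3 (3.4)–(3.5), §4 p. 8
  (arXiv:0709.3599). [KochNadirashviliSereginSverak2009]
-/

noncomputable section

-- single-conjunct summit: `Summit.<Summit>.<Problem>` repeats the name by the D-0017 layout
set_option linter.dupNamespace false

namespace Summit.NavierStokesRegularity.NavierStokesRegularity.Theorems.PlanarEnergyAPriori.SmallData

open MeasureTheory Set Function Filter Topology TopologicalSpace Metric WithLp
open scoped NNReal ENNReal
open Literature.Analysis Literature.Analysis.FluidPDE Literature.Analysis.FunctionSpaces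

/-! ### Planes and their translates -/

/-- **A translate of a plane is a plane**: for a linear isometry `R` of `ℝ³`, `c ∈ ℝ`, `y ∈ ℝ²`
and `z ∈ ℝ³`, `R(y₀, y₁, c) − z = R((y − w)₀, (y − w)₁, c − (R⁻¹z)₂)` with `w = ((R⁻¹z)₀, (R⁻¹z)₁)`.
[folklore] -/
theorem plane_sub (R : EuclideanSpace ℝ (Fin 3) ≃ₗᵢ[ℝ] EuclideanSpace ℝ (Fin 3)) (c : ℝ)
    (y : EuclideanSpace ℝ (Fin 2)) (z : EuclideanSpace ℝ (Fin 3)) :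
    R (toLp 2 ![y 0, y 1, c]) - z =
      R (toLp 2 ![(y - toLp 2 ![R.symm z 0, R.symm z 1]) 0, (y - toLp 2 ![R.symm z 0, R.symm z 1]) 1,
        c - R.symm z 2]) := by
  have h1 : R (toLp 2 ![y 0, y 1, c]) - z = R (toLp 2 ![y 0, y 1, c] - R.symm z) := by
    rw [map_sub, LinearIsometryEquiv.apply_symm_apply]
  rw [h1]
  congr 1
  ext i
  fin_cases i <;> simp

/-- **Planar energies through translated parametrisations**: for every `f : ℝ³ → F`,
`∫ ‖f(R(y₀,y₁,c) − z)‖² dy = ∫ ‖f(R(y₀,y₁,c − (R⁻¹z)₂))‖² dy` (translation invariance of Lebesgue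
measure on `ℝ²`). [folklore] -/
theorem lintegral_plane_translate {F : Type*} [NormedAddCommGroup F] (f : EuclideanSpace ℝ (Fin 3) → F)
    (R : EuclideanSpace ℝ (Fin 3) ≃ₗᵢ[ℝ] EuclideanSpace ℝ (Fin 3)) (c : ℝ) (z : EuclideanSpace ℝ (Fin 3)) :
    ∫⁻ y : EuclideanSpace ℝ (Fin 2), ‖f (R (toLp 2 ![y 0, y 1, c]) - z)‖ₑ ^ 2 =
      ∫⁻ y : EuclideanSpace ℝ (Fin 2), ‖f (R (toLp 2 ![y 0, y 1, c - R.symm z 2]))‖ₑ ^ 2 := by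
  set w : EuclideanSpace ℝ (Fin 2) := toLp 2 ![R.symm z 0, R.symm z 1] with hw
  have h : ∀ y : EuclideanSpace ℝ (Fin 2), ‖f (R (toLp 2 ![y 0, y 1, c]) - z)‖ₑ ^ 2 =
      (fun y' : EuclideanSpace ℝ (Fin 2) =>
        ‖f (R (toLp 2 ![y' 0, y' 1, c - R.symm z 2]))‖ₑ ^ 2) (y - w) := fun y => by
    simp only [hw]
    rw [plane_sub]
  simp_rw [h]
  exact lintegral_sub_right_eq_self
    (fun y' : EuclideanSpace ℝ (Fin 2) => ‖f (R (toLp 2 ![y' 0, y' 1, c - R.symm z 2]))‖ₑ ^ 2) w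

/-- **A planar ceiling is translation invariant**: if `∫ ‖f(R(y₀,y₁,c))‖² dy ≤ X` for all `R`, `c`,
then also `∫ ‖f(R(y₀,y₁,c) − z)‖² dy ≤ X` for every `z`. [folklore] -/
theorem planar_translate_le {F : Type*} [NormedAddCommGroup F] {f : EuclideanSpace ℝ (Fin 3) → F}
    {X : ℝ≥0∞}
    (hX : ∀ (R : EuclideanSpace ℝ (Fin 3) ≃ₗᵢ[ℝ] EuclideanSpace ℝ (Fin 3)) (c : ℝ),
      ∫⁻ y : EuclideanSpace ℝ (Fin 2), ‖f (R (toLp 2 ![y 0, y 1, c]))‖ₑ ^ 2 ≤ X)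
    (R : EuclideanSpace ℝ (Fin 3) ≃ₗᵢ[ℝ] EuclideanSpace ℝ (Fin 3)) (c : ℝ) (z : EuclideanSpace ℝ (Fin 3)) :
    ∫⁻ y : EuclideanSpace ℝ (Fin 2), ‖f (R (toLp 2 ![y 0, y 1, c]) - z)‖ₑ ^ 2 ≤ X := by
  rw [lintegral_plane_translate]
  exact hX R _

/-- The plane parametrisation `y ↦ R(y₀, y₁, c)` is continuous. [folklore] -/
theorem continuous_plane (R : EuclideanSpace ℝ (Fin 3) ≃ₗᵢ[ℝ] EuclideanSpace ℝ (Fin 3)) (c : ℝ) :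
    Continuous fun y : EuclideanSpace ℝ (Fin 2) => R (toLp 2 ![y 0, y 1, c]) := by
  refine R.continuous.comp ?_
  refine (PiLp.continuous_toLp 2 _).comp ?_
  refine continuous_pi fun i => ?_
  fin_cases i
  · simpa using (PiLp.continuous_apply 2 (fun _ : Fin 2 => ℝ) 0)
  · simpa using (PiLp.continuous_apply 2 (fun _ : Fin 2 => ℝ) 1)
  · simpa using continuous_const

/-! ### `L²` seminorms and squares -/

/-- `‖g‖_{L²}² = ∫ ‖g‖ₑ²` (the `L²` seminorm squared is the integral of the square). [folklore] -/
theorem eLpNorm_two_rpow_two {α F : Type*} [MeasurableSpace α] {μ : Measure α} [NormedAddCommGroup F]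
    (g : α → F) : eLpNorm g 2 μ ^ (2 : ℝ) = ∫⁻ x, ‖g x‖ₑ ^ 2 ∂μ := by
  rw [eLpNorm_eq_lintegral_rpow_enorm_toReal two_ne_zero ENNReal.ofNat_ne_top, ENNReal.toReal_ofNat,
    ← ENNReal.rpow_mul, one_div, inv_mul_cancel₀ two_ne_zero, ENNReal.rpow_one]
  refine lintegral_congr fun x => ?_
  rw [ENNReal.rpow_two]

/-- `‖g‖_{L²} = (∫ ‖g‖ₑ²)^{1/2}`. [folklore] -/
theorem eLpNorm_two_eq_rpow_half {α F : Type*} [MeasurableSpace α] {μ : Measure α} [NormedAddCommGroup F]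
    (g : α → F) : eLpNorm g 2 μ = (∫⁻ x, ‖g x‖ₑ ^ 2 ∂μ) ^ (1 / 2 : ℝ) := by
  rw [← eLpNorm_two_rpow_two, ← ENNReal.rpow_mul, one_div, mul_inv_cancel₀ two_ne_zero,
    ENNReal.rpow_one]

/-- If `‖g‖_{L²} ≤ Y` then `∫ ‖g‖ₑ² ≤ Y²`. [folklore] -/
theorem lintegral_le_of_eLpNorm_two_le {α F : Type*} [MeasurableSpace α] {μ : Measure α}
    [NormedAddCommGroup F] {g : α → F} {Y : ℝ≥0∞} (h : eLpNorm g 2 μ ≤ Y) :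
    ∫⁻ x, ‖g x‖ₑ ^ 2 ∂μ ≤ Y ^ (2 : ℝ) := by
  rw [← eLpNorm_two_rpow_two]
  exact ENNReal.rpow_le_rpow h (by norm_num)

/-! ### The heat flow does not increase planar energies -/

/-- **Planar energies under the heat flow.** If a continuous field `f` on `ℝ³` has planar energies
`≤ X` on every plane, then so does `e^{σΔ} f`, `σ > 0`: by Minkowski's integral inequality in the
kernel variable, `‖(e^{σΔ}f)∘Pl‖_{L²(ℝ²)} ≤ ∫ G_σ(z) ‖f(Pl· − z)‖_{L²} dz ≤ X^{1/2}` for every plane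
parametrisation `Pl`, the translates of `Pl` being planes. [cite: SteinSingularIntegrals1970, App. A.1] -/
theorem planar_heatExtension_le {f : EuclideanSpace ℝ (Fin 3) → EuclideanSpace ℝ (Fin 3)}
    (hf : Continuous f) {X : ℝ≥0∞}
    (hX : ∀ (R : EuclideanSpace ℝ (Fin 3) ≃ₗᵢ[ℝ] EuclideanSpace ℝ (Fin 3)) (c : ℝ),
      ∫⁻ y : EuclideanSpace ℝ (Fin 2), ‖f (R (toLp 2 ![y 0, y 1, c]))‖ₑ ^ 2 ≤ X)
    {σ : ℝ} (hσ : 0 < σ) (R : EuclideanSpace ℝ (Fin 3) ≃ₗᵢ[ℝ] EuclideanSpace ℝ (Fin 3)) (c : ℝ) :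
    ∫⁻ y : EuclideanSpace ℝ (Fin 2),
      ‖UnboundedOperators.heatExtension f σ (R (toLp 2 ![y 0, y 1, c]))‖ₑ ^ 2 ≤ X := by
  set Pl : EuclideanSpace ℝ (Fin 2) → EuclideanSpace ℝ (Fin 3) := fun y => R (toLp 2 ![y 0, y 1, c])
    with hPl
  have hPlc : Continuous Pl := continuous_plane R c
  -- the Minkowski integrand
  set G : EuclideanSpace ℝ (Fin 2) → EuclideanSpace ℝ (Fin 3) → EuclideanSpace ℝ (Fin 3) :=
    fun y z => UnboundedOperators.heatKernel σ z • f (Pl y - z) with hG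
  have hGm : AEStronglyMeasurable (uncurry G)
      ((volume : Measure (EuclideanSpace ℝ (Fin 2))).prod (volume : Measure (EuclideanSpace ℝ (Fin 3)))) := by
    refine Continuous.aestronglyMeasurable ?_
    exact ((UnboundedOperators.continuous_heatKernel σ).comp continuous_snd).smul
      (hf.comp ((hPlc.comp continuous_fst).sub continuous_snd))
  have hrepr : ∀ y, UnboundedOperators.heatExtension f σ (Pl y) = ∫ z, G y z := fun y => by
    rw [UnboundedOperators.heatExtension_apply]
  -- Minkowski
  have hM := eLpNorm_integral_le_lintegral_eLpNorm (μ := (volume : Measure (EuclideanSpace ℝ (Fin 2))))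
    (ν := (volume : Measure (EuclideanSpace ℝ (Fin 3)))) hGm (p := 2) one_le_two ENNReal.ofNat_ne_top
  -- the slices
  have hslice : ∀ z, eLpNorm (fun y => G y z) 2 volume ≤
      ‖UnboundedOperators.heatKernel σ z‖ₑ * X ^ (1 / 2 : ℝ) := by
    intro z
    have h1 : eLpNorm (fun y => G y z) 2 volume =
        ‖UnboundedOperators.heatKernel σ z‖ₑ * eLpNorm (fun y => f (Pl y - z)) 2 volume := by
      rw [← eLpNorm_const_smul]
      rfl
    rw [h1]
    exact mul_le_mul_right (eLpNorm_two_le_rpow_of_lintegral_sq_le (planar_translate_le hX R c z)) _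
  have hbound : eLpNorm (fun y => UnboundedOperators.heatExtension f σ (Pl y)) 2 volume ≤ X ^ (1 / 2 : ℝ) := by
    calc eLpNorm (fun y => UnboundedOperators.heatExtension f σ (Pl y)) 2 volume
        = eLpNorm (fun y => ∫ z, G y z) 2 volume := by simp_rw [hrepr]
      _ ≤ ∫⁻ z, eLpNorm (fun y => G y z) 2 volume := hM
      _ ≤ ∫⁻ z, ‖UnboundedOperators.heatKernel σ z‖ₑ * X ^ (1 / 2 : ℝ) := lintegral_mono hslice
      _ = (∫⁻ z, ‖UnboundedOperators.heatKernel (E := EuclideanSpace ℝ (Fin 3)) σ z‖ₑ) * X ^ (1 / 2 : ℝ) :=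
          lintegral_mul_const _ (UnboundedOperators.continuous_heatKernel σ).measurable.enorm
      _ = X ^ (1 / 2 : ℝ) := by rw [UnboundedOperators.lintegral_enorm_heatKernel hσ, one_mul]
  have h := lintegral_le_of_eLpNorm_two_le hbound
  rwa [← ENNReal.rpow_mul, one_div, inv_mul_cancel₀ two_ne_zero, ENNReal.rpow_one] at h

/-! ### The Oseen slice operator on planes -/

/-- **Planar energies of the Oseen slice `N_τ[a, b]`.** There is an absolute `C₁ > 0` such that
for continuous fields `a`, `b` on `ℝ³` with `‖a‖ ≤ A` and planar energies of `b` bounded by `X`,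
`(∫_{plane} ‖N_τ[a,b]‖²)^{1/2} ≤ C₁ τ^{-1/2} A X^{1/2}` on every plane, `τ > 0`: Minkowski's
integral inequality with the Koch–Tataru envelope `‖K(τ,z)[α,β]‖ ≤ C (τ+‖z‖²)^{-2}‖α‖‖β‖`, whose
mass is `C I τ^{-1/2}`. [cite: KochNadirashviliSereginSverak2009, §3 (3.4)–(3.5); SteinSingularIntegrals1970, App. A.1] -/
theorem planar_oseenSlice_le :
    ∃ C₁ : ℝ, 0 < C₁ ∧ ∀ {a b : EuclideanSpace ℝ (Fin 3) → EuclideanSpace ℝ (Fin 3)},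
      Continuous a → Continuous b → ∀ {A : ℝ}, (∀ x, ‖a x‖ ≤ A) → ∀ {X : ℝ≥0∞},
      (∀ (R : EuclideanSpace ℝ (Fin 3) ≃ₗᵢ[ℝ] EuclideanSpace ℝ (Fin 3)) (c : ℝ),
        ∫⁻ y : EuclideanSpace ℝ (Fin 2), ‖b (R (toLp 2 ![y 0, y 1, c]))‖ₑ ^ 2 ≤ X) →
      ∀ {τ : ℝ}, 0 < τ → ∀ (R : EuclideanSpace ℝ (Fin 3) ≃ₗᵢ[ℝ] EuclideanSpace ℝ (Fin 3)) (c : ℝ),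
        eLpNorm (fun y : EuclideanSpace ℝ (Fin 2) => oseenSlice τ a b (R (toLp 2 ![y 0, y 1, c]))) 2 volume ≤
          ENNReal.ofReal (C₁ * τ ^ (-(1 / 2 : ℝ)) * A) * X ^ (1 / 2 : ℝ) := by
  obtain ⟨C, hC, hK⟩ := exists_norm_oseenKernel_le (E := EuclideanSpace ℝ (Fin 3))
  set I : ℝ := ∫ w : EuclideanSpace ℝ (Fin 3),
    (1 + ‖w‖ ^ 2) ^ (-(((Module.finrank ℝ (EuclideanSpace ℝ (Fin 3)) : ℝ) + 1) / 2)) with hI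
  have hI0 : 0 < I := integral_one_add_norm_sq_rpow_neg_pos (by linarith)
  refine ⟨C * I, by positivity, ?_⟩
  intro a b ha hb A hA X hX τ hτ R c
  have hA0 : 0 ≤ A := (norm_nonneg _).trans (hA 0)
  set Pl : EuclideanSpace ℝ (Fin 2) → EuclideanSpace ℝ (Fin 3) := fun y => R (toLp 2 ![y 0, y 1, c])
    with hPl
  have hPlc : Continuous Pl := continuous_plane R c
  -- the envelope
  set wt : EuclideanSpace ℝ (Fin 3) → ℝ := fun z =>
    (τ + ‖z‖ ^ 2) ^ (-(((Module.finrank ℝ (EuclideanSpace ℝ (Fin 3)) : ℝ) + 1) / 2)) with hwt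
  have hwt0 : ∀ z, 0 ≤ wt z := fun z => Real.rpow_nonneg (by positivity) _
  have hwti : Integrable wt := integrable_add_norm_sq_rpow_neg_half_succ hτ
  -- the Minkowski integrand (translated form of the slice)
  set G : EuclideanSpace ℝ (Fin 2) → EuclideanSpace ℝ (Fin 3) → EuclideanSpace ℝ (Fin 3) :=
    fun y z => oseenKernel τ z (a (Pl y - z)) (b (Pl y - z)) with hG
  have hGm : AEStronglyMeasurable (uncurry G)
      ((volume : Measure (EuclideanSpace ℝ (Fin 2))).prod (volume : Measure (EuclideanSpace ℝ (Fin 3)))) := by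
    have hsub : Measurable fun q : EuclideanSpace ℝ (Fin 2) × EuclideanSpace ℝ (Fin 3) => Pl q.1 - q.2 :=
      ((hPlc.comp continuous_fst).sub continuous_snd).measurable
    exact (Measurable.oseenKernel_comp measurable_const measurable_snd
      (ha.measurable.comp hsub) (hb.measurable.comp hsub)).aestronglyMeasurable
  have hrepr : ∀ y, oseenSlice τ a b (Pl y) = ∫ z, G y z := fun y => by
    rw [oseenSlice_eq_integral_sub]
  have hM := eLpNorm_integral_le_lintegral_eLpNorm (μ := (volume : Measure (EuclideanSpace ℝ (Fin 2))))
    (ν := (volume : Measure (EuclideanSpace ℝ (Fin 3)))) hGm (p := 2) one_le_two ENNReal.ofNat_ne_top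
  -- the slices: `‖G y z‖ ≤ (C wt z A) ‖b(Pl y − z)‖`
  have hslice : ∀ z, eLpNorm (fun y => G y z) 2 volume ≤
      ENNReal.ofReal (C * wt z * A) * X ^ (1 / 2 : ℝ) := by
    intro z
    have hpt : ∀ y, ‖G y z‖ ≤ ‖(C * wt z * A) • b (Pl y - z)‖ := by
      intro y
      rw [norm_smul, Real.norm_of_nonneg (by have := hwt0 z; positivity)]
      calc ‖G y z‖ ≤ C * wt z * ‖a (Pl y - z)‖ * ‖b (Pl y - z)‖ := hK hτ z _ _
        _ ≤ C * wt z * A * ‖b (Pl y - z)‖ := by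
            have := hwt0 z
            gcongr
            exact hA _
    calc eLpNorm (fun y => G y z) 2 volume
        ≤ eLpNorm (fun y => (C * wt z * A) • b (Pl y - z)) 2 volume :=
          eLpNorm_mono fun y => hpt y
      _ = ‖C * wt z * A‖ₑ * eLpNorm (fun y => b (Pl y - z)) 2 volume := by
          rw [← eLpNorm_const_smul]; rfl
      _ ≤ ENNReal.ofReal (C * wt z * A) * X ^ (1 / 2 : ℝ) := by
          rw [Real.enorm_eq_ofReal (by have := hwt0 z; positivity)]
          exact mul_le_mul_right (eLpNorm_two_le_rpow_of_lintegral_sq_le (planar_translate_le hX R c z)) _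
  -- the mass of the envelope
  have hmass : ∫⁻ z, ENNReal.ofReal (C * wt z * A) = ENNReal.ofReal (C * I * τ ^ (-(1 / 2 : ℝ)) * A) := by
    have h1 : ∀ z, ENNReal.ofReal (C * wt z * A) = ENNReal.ofReal (C * A) * ENNReal.ofReal (wt z) := by
      intro z
      rw [← ENNReal.ofReal_mul (by positivity)]
      ring_nf
    simp_rw [h1]
    rw [lintegral_const_mul' _ _ ENNReal.ofReal_ne_top,
      ← ofReal_integral_eq_lintegral_ofReal hwti (Eventually.of_forall hwt0),
      ← ENNReal.ofReal_mul (by positivity)]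
    congr 1
    rw [hwt, integral_add_norm_sq_rpow_neg_half_succ hτ, ← hI]
    ring
  calc eLpNorm (fun y => oseenSlice τ a b (Pl y)) 2 volume
      = eLpNorm (fun y => ∫ z, G y z) 2 volume := by simp_rw [hrepr]
    _ ≤ ∫⁻ z, eLpNorm (fun y => G y z) 2 volume := hM
    _ ≤ ∫⁻ z, ENNReal.ofReal (C * wt z * A) * X ^ (1 / 2 : ℝ) := lintegral_mono hslice
    _ = (∫⁻ z, ENNReal.ofReal (C * wt z * A)) * X ^ (1 / 2 : ℝ) := by
        refine lintegral_mul_const'' _ ?_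
        exact ((hwti.aestronglyMeasurable.aemeasurable.const_mul C).mul_const A).ennreal_ofReal
    _ = ENNReal.ofReal (C * I * τ ^ (-(1 / 2 : ℝ)) * A) * X ^ (1 / 2 : ℝ) := by rw [hmass]

/-! ### The bilinear Duhamel term on planes: Minkowski in time -/

/-- **Planar energies of the Duhamel term `B_{t₀}(w,w)(t)`** (Minkowski's integral inequality in
time). Let `w : ℝ → ℝ³ → ℝ³` be jointly measurable and suppose that for every `s ∈ (t₀, t)` the
planar `L²` norms of the slice `N_{t−s}[w(s), w(s)]` are bounded by `m s` on every plane. Then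
`‖B_{t₀}(w,w)(t) ∘ Pl‖_{L²(ℝ²)} ≤ ∫_{t₀}^t m(s) ds` for every plane parametrisation `Pl`.
[cite: SteinSingularIntegrals1970, App. A.1; KochNadirashviliSereginSverak2009, §4 p. 8] -/
theorem planar_oseenDuhamel_le {w : ℝ → EuclideanSpace ℝ (Fin 3) → EuclideanSpace ℝ (Fin 3)}
    (hw : Measurable (uncurry w)) {t₀ t : ℝ} {m : ℝ → ℝ≥0∞}
    (hm : ∀ s ∈ Ioo t₀ t, ∀ (R : EuclideanSpace ℝ (Fin 3) ≃ₗᵢ[ℝ] EuclideanSpace ℝ (Fin 3)) (c : ℝ),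
      eLpNorm (fun y : EuclideanSpace ℝ (Fin 2) =>
        oseenSlice (t - s) (w s) (w s) (R (toLp 2 ![y 0, y 1, c]))) 2 volume ≤ m s)
    (R : EuclideanSpace ℝ (Fin 3) ≃ₗᵢ[ℝ] EuclideanSpace ℝ (Fin 3)) (c : ℝ) :
    eLpNorm (fun y : EuclideanSpace ℝ (Fin 2) => oseenDuhamel 1 t₀ w w t (R (toLp 2 ![y 0, y 1, c]))) 2 volume ≤
      ∫⁻ s in Ioo t₀ t, m s := by
  set Pl : EuclideanSpace ℝ (Fin 2) → EuclideanSpace ℝ (Fin 3) := fun y => R (toLp 2 ![y 0, y 1, c])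
    with hPl
  have hPlc : Continuous Pl := continuous_plane R c
  -- joint measurability from the parametric slice lemma
  have hSM := stronglyMeasurable_oseenSlice_duhamel (1 : ℝ) t hw hw
  have hGm : AEStronglyMeasurable
      (uncurry fun (y : EuclideanSpace ℝ (Fin 2)) (s : ℝ) => oseenSlice (t - s) (w s) (w s) (Pl y))
      ((volume : Measure (EuclideanSpace ℝ (Fin 2))).prod ((volume : Measure ℝ).restrict (Ioo t₀ t))) := by
    have hg : Measurable (fun q : EuclideanSpace ℝ (Fin 2) × ℝ => ((q.2, Pl q.1) : ℝ × EuclideanSpace ℝ (Fin 3))) :=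
      measurable_snd.prodMk (hPlc.measurable.comp measurable_fst)
    have h1 : StronglyMeasurable
        ((fun q : ℝ × EuclideanSpace ℝ (Fin 3) => oseenSlice (1 * (t - q.1)) (w q.1) (w q.1) q.2) ∘
          (fun q : EuclideanSpace ℝ (Fin 2) × ℝ => ((q.2, Pl q.1) : ℝ × EuclideanSpace ℝ (Fin 3)))) :=
      hSM.comp_measurable hg
    refine h1.aestronglyMeasurable.congr (Eventually.of_forall fun q => ?_)
    simp only [Function.comp_apply, Function.uncurry, one_mul]
  have hrepr : ∀ y, oseenDuhamel 1 t₀ w w t (Pl y) =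
      ∫ s in Ioo t₀ t, oseenSlice (t - s) (w s) (w s) (Pl y) := fun y => by
    rw [oseenDuhamel_one_eq_setIntegral_oseenSlice]
  have hM := eLpNorm_integral_le_lintegral_eLpNorm (μ := (volume : Measure (EuclideanSpace ℝ (Fin 2))))
    (ν := ((volume : Measure ℝ).restrict (Ioo t₀ t))) hGm (p := 2) one_le_two ENNReal.ofNat_ne_top
  calc eLpNorm (fun y => oseenDuhamel 1 t₀ w w t (Pl y)) 2 volume
      = eLpNorm (fun y => ∫ s in Ioo t₀ t, oseenSlice (t - s) (w s) (w s) (Pl y)) 2 volume := by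
        simp_rw [hrepr]
    _ ≤ ∫⁻ s in Ioo t₀ t, eLpNorm (fun y => oseenSlice (t - s) (w s) (w s) (Pl y)) 2 volume := hM
    _ ≤ ∫⁻ s in Ioo t₀ t, m s := by
        refine setLIntegral_mono' measurableSet_Ioo fun s hs => ?_
        exact hm s hs R c

/-! ### Measurability of the planar traces -/

/-- The planar trace `y ↦ (e^{σΔ}f)(R(y₀,y₁,c))` of the caloric extension of a continuous field is
a.e.-strongly measurable (a parametric Bochner integral of a jointly continuous integrand). [folklore] -/
theorem aestronglyMeasurable_plane_heatExtension {f : EuclideanSpace ℝ (Fin 3) → EuclideanSpace ℝ (Fin 3)}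
    (hf : Continuous f) (σ : ℝ) (R : EuclideanSpace ℝ (Fin 3) ≃ₗᵢ[ℝ] EuclideanSpace ℝ (Fin 3)) (c : ℝ) :
    AEStronglyMeasurable (fun y : EuclideanSpace ℝ (Fin 2) =>
      UnboundedOperators.heatExtension f σ (R (toLp 2 ![y 0, y 1, c]))) volume := by
  set Pl : EuclideanSpace ℝ (Fin 2) → EuclideanSpace ℝ (Fin 3) := fun y => R (toLp 2 ![y 0, y 1, c])
    with hPl
  have hPlc : Continuous Pl := continuous_plane R c
  have hGm : AEStronglyMeasurable
      (uncurry fun (y : EuclideanSpace ℝ (Fin 2)) (z : EuclideanSpace ℝ (Fin 3)) =>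
        UnboundedOperators.heatKernel σ z • f (Pl y - z))
      ((volume : Measure (EuclideanSpace ℝ (Fin 2))).prod (volume : Measure (EuclideanSpace ℝ (Fin 3)))) := by
    refine Continuous.aestronglyMeasurable ?_
    exact ((UnboundedOperators.continuous_heatKernel σ).comp continuous_snd).smul
      (hf.comp ((hPlc.comp continuous_fst).sub continuous_snd))
  have h := hGm.integral_prod_right'
  refine h.congr (Eventually.of_forall fun y => ?_)
  simp only [Function.uncurry]
  rw [UnboundedOperators.heatExtension_apply]

/-- The planar trace `y ↦ B_{t₀}(w,w)(t)(R(y₀,y₁,c))` of the Duhamel term of a jointly measurable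
field is a.e.-strongly measurable. [folklore] -/
theorem aestronglyMeasurable_plane_oseenDuhamel {w : ℝ → EuclideanSpace ℝ (Fin 3) → EuclideanSpace ℝ (Fin 3)}
    (hw : Measurable (uncurry w)) (t₀ t : ℝ) (R : EuclideanSpace ℝ (Fin 3) ≃ₗᵢ[ℝ] EuclideanSpace ℝ (Fin 3))
    (c : ℝ) :
    AEStronglyMeasurable (fun y : EuclideanSpace ℝ (Fin 2) =>
      oseenDuhamel 1 t₀ w w t (R (toLp 2 ![y 0, y 1, c]))) volume := by
  set Pl : EuclideanSpace ℝ (Fin 2) → EuclideanSpace ℝ (Fin 3) := fun y => R (toLp 2 ![y 0, y 1, c])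
    with hPl
  have hPlc : Continuous Pl := continuous_plane R c
  have hSM := stronglyMeasurable_oseenSlice_duhamel (1 : ℝ) t hw hw
  have hGm : AEStronglyMeasurable
      (uncurry fun (y : EuclideanSpace ℝ (Fin 2)) (s : ℝ) => oseenSlice (t - s) (w s) (w s) (Pl y))
      ((volume : Measure (EuclideanSpace ℝ (Fin 2))).prod ((volume : Measure ℝ).restrict (Ioo t₀ t))) := by
    have hg : Measurable (fun q : EuclideanSpace ℝ (Fin 2) × ℝ => ((q.2, Pl q.1) : ℝ × EuclideanSpace ℝ (Fin 3))) :=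
      measurable_snd.prodMk (hPlc.measurable.comp measurable_fst)
    have h1 : StronglyMeasurable
        ((fun q : ℝ × EuclideanSpace ℝ (Fin 3) => oseenSlice (1 * (t - q.1)) (w q.1) (w q.1) q.2) ∘
          (fun q : EuclideanSpace ℝ (Fin 2) × ℝ => ((q.2, Pl q.1) : ℝ × EuclideanSpace ℝ (Fin 3)))) :=
      hSM.comp_measurable hg
    refine h1.aestronglyMeasurable.congr (Eventually.of_forall fun q => ?_)
    simp only [Function.comp_apply, Function.uncurry, one_mul]
  have h := hGm.integral_prod_right'
  refine h.congr (Eventually.of_forall fun y => ?_)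
  simp only [Function.uncurry]
  rw [oseenDuhamel_one_eq_setIntegral_oseenSlice]

/-! ### Registered form -/

/-- **The heat flow does not increase planar kinetic energies** (registered sub-goal of
stmt-NavierStokesRegularity-16855, the closed form of `planar_heatExtension_le`): for a continuous
field on `ℝ³` whose planar energies are `≤ X` on every plane `R({x₂ = c})`, every caloric extension
`e^{σΔ} f`, `σ > 0`, has planar energies `≤ X` on every plane. [cite: SteinSingularIntegrals1970, App. A.1] -/
theorem planarEnergy_heatExtension_le :
    ∀ (f : EuclideanSpace ℝ (Fin 3) → EuclideanSpace ℝ (Fin 3)), Continuous f → ∀ (X : ENNReal),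
      (∀ (R : EuclideanSpace ℝ (Fin 3) ≃ₗᵢ[ℝ] EuclideanSpace ℝ (Fin 3)) (c : ℝ),
        ∫⁻ y : EuclideanSpace ℝ (Fin 2), ‖f (R (WithLp.toLp 2 ![y 0, y 1, c]))‖ₑ ^ 2 ≤ X) →
      ∀ (σ : ℝ), 0 < σ → ∀ (R : EuclideanSpace ℝ (Fin 3) ≃ₗᵢ[ℝ] EuclideanSpace ℝ (Fin 3)) (c : ℝ),
        ∫⁻ y : EuclideanSpace ℝ (Fin 2),
          ‖Literature.Analysis.UnboundedOperators.heatExtension f σ (R (WithLp.toLp 2 ![y 0, y 1, c]))‖ₑ ^ 2 ≤ X :=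
  fun _ hf _ hX _ hσ R c => planar_heatExtension_le hf hX hσ R c

end Summit.NavierStokesRegularity.NavierStokesRegularity.Theorems.PlanarEnergyAPriori.SmallData

end
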